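import Literature.NumberTheory.EllipticCurves.YanZhu2026.OrdinaryMainConjectureEqualityProofs
import Literature.NumberTheory.EllipticCurves.YanZhu2026.CyclotomicMainTheoremRational
import Literature.NumberTheory.EllipticCurves.CyclotomicIwasawaMainTheoremIrreducibleMuZeroProofs
import Literature.NumberTheory.EllipticCurves.PAdicBSDProofs
import HarnessLib

/-!
# Yan–Zhu 2026 (J. Algebra 693 = arXiv:2412.20078v4), proof of the cyclotomic main theorem (v4 Thm.
# 5.2 = v2 Thm. 4.9): the TWO-FOLD PRODUCT divisibility
# `Char(X(E/ℚ_∞)) · Char(X(E^K/ℚ_∞)) ⊆ (𝓛_p^MSD(E/ℚ) · 𝓛_p^MSD(E^K/ℚ))` in `Λ_ℚ`, PROVED from its printed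
# inputs; and Mazur's identity `Char(X(E/ℚ_∞)) = (L_p(f_E, α))` IN `Λ_ℚ` from it and `μ = 0` at `E`, `E^K`

`Proofs` companion (theorems only: no definition, no named fact) of
`YanZhu2026/TwoVariableMainTheorems.lean` (facts `thm42_XOrd₂_isTorsion_charIdeal_le_perrinRiou`, whose
fourth clause is the divisibility (DIV) `Char_{Λ_K}(𝒳_{𝓕_ord}(E/K_∞)) ⊂ (𝓛_p^PR(E/K))` of Thm. 4.2 (1),
and `lemma53_charIdeal_mul_charIdeal_le_toPlus_charIdeal`, the descent lemma of v4 §5.1),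
`YanZhu2026/PerrinRiouCyclotomicRestriction.lean` (`prop37_cycRestrict_perrinRiou_eq_padicLFunction_mul`,
Prop. 3.7 at print strength) and `YanZhu2026/CyclotomicMainTheoremRational.lean` (the rational clause
`thm49_charIdeal_eq_padicLFunction`), after the model `YanZhu2026/OrdinaryMainConjectureEqualityProofs.lean`
§B (which runs the same algebra for the (Im) clause). Cell `pub/bsd-print-x9` (D-0131 (2) print tier),
seat `bsd-print-x9-p1`; written in answer to the review of p537205 (the display had been filed as a
named fact; the reviewer: "ALL THREE [inputs] are already tree facts … FIX: file the display as a
THEOREM"). HONEST FRAMING: typed ≠ proved ≠ endorsed; nothing here proves BSD; these are kernel EDGES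
between named print nodes; the cell flag `YZ26@3-BF-ERL-Ohta` of the Yan–Zhu facts travels with them.

## What is proved (source: v4 TeX l.1141–1160, "Proof of Theorem 5.2": "Applying Theorem 4.2,
Proposition [PR-MSD], and the preceding lemma, we obtain `Char(𝒳(E/ℚ_∞)) · Char(𝒳(E^K/ℚ_∞)) ⊂
Char_{Λ_K}(𝒳(E/K_∞)) mod I ⊂ (𝓛_p^PR(E/K)) mod I = (𝓛_p^PR(E/K)⁺) = (𝓛_p^MSD(E/ℚ))·(𝓛_p^MSD(E^K/ℚ))`
in `Λ_ℚ ≃ Λ_K⁺`")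

For the two-variable data of §B of the model file — `W` a globally minimal model of `E/ℚ`,
`π : X₀(N) → E` with `N = N_E`, `3 ≤ p` good ordinary, `E[p]` irreducible over `ℚ` and over `K`, `K`
imaginary quadratic with `p` split and `(N_E, D_K) = 1`, the cyclotomic/anticyclotomic pair
`(κ₁, κ₂; γ₁, γ₂)` with `γ₁|_{ℚ̄}` a generator of the cyclotomic `ℤ_p`-extension `κ` of `ℚ` matching the
cyclotomic variable, a cyclotomic generator `γ` for the dual data `D` (`X(E/ℚ_∞)`) and `D'`
(`X(E^K/ℚ_∞)` on `W.quadraticTwist D_K`), the Néron ratios `ϖ, ϖ'` (`p`-adic units) and a globally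
minimal model `W'` of `E^K` with newform `g`, good ordinary at `p`, and the type-I frame `F` of (DIV):
* §1 **`prod_charIdeal_le_span_of_facts`** — granted `lemma53_…`, `prop37_…` and (DIV) as a hypothesis
  (`hdiv`, the fourth clause of `thm42_…`): `Char(X(E/ℚ_∞)) · Char(X(E^K/ℚ_∞)) ⊆ (G₀)` for a `G₀ ∈ Λ_ℚ`
  with `ι G₀ = (ϖ · L_p(f_E, α)) · (ϖ' · L_p(g, α'))` — the printed display. Proof: for `g ∈ Char(X(E))`,
  `g' ∈ Char(X(E^K))`, Lemma 5.3 gives `G ∈ Char(X(E/K_∞))` with `Ḡ = g g'`; (DIV) gives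
  `ι(G) = 𝓛 · ι(h)`; on the cyclotomic line `ι(g g') = 𝓛⁺ · ι(h̄)` and Prop. 3.7 reads
  `𝓛⁺ = ι(u) · ϖϖ' · L_p(f_E) L_p(g)`; `ϖ L_p(f_E), ϖ' L_p(g) ∈ ι(Λ_ℚ)` (Greenberg–Vatsal Prop. 3.7, tree
  theorem `padicLFunction_mem_integral_holds`), so `g g' = u · G₀ · h̄ ∈ (G₀)` by injectivity of `ι`.
* §2 **`charIdeal_eq_padicLFunction_of_mu_eq_zero_of_facts`** — adding the rational clause
  `thm49_charIdeal_eq_padicLFunction` (for `E` and for the minimal model of `E^K`) and the OPEN binders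
  `μ(X(E/ℚ_∞)) = 0`, `μ(X(E^K/ℚ_∞)) = 0` (Greenberg's Conj. 1.11 at the two curves): `X(E/ℚ_∞)` is torsion
  and `Char(X(E/ℚ_∞)) = (g₀)` with `ι g₀ = L_p(f_E, α)` on the nose — by the `μ`-arithmetic of
  `CyclotomicIwasawaMainTheoremIrreducibleMuZeroProofs` (`kᵢ ≤ 0` from unit content and integrality;
  `k + k' ≥ 0` from §1; `exponents_eq_zero_of_prod_mem_span` padded).

What is NOT here (numbers, not adjectives): the EXISTENCE of the two-variable data for a given
`(E, p)` and cyclotomic datum over `ℚ` — an imaginary quadratic `K` with every `ℓ ∣ pN` split and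
`ρ̄_E|_{G_K}` absolutely irreducible (the printed "Choose …"; arithmetic half proved in the tree,
`exists_auxiliaryImaginaryQuadraticDiscr`; Galois half `MatarNekovar2019.prop526_…`), a
cyclotomic/anticyclotomic generator pair `(κ₁, κ₂; γ₁, γ₂)` of `K` with `γ₁|_{ℚ̄}` generating `κ`
(`ZpExtension.IsTopGeneratorPair`: no existence theorem in the tree), and `ι : ℤ̄ → ℂ_p`. Hence both
theorems are PARAMETRIC in these data, exactly like §B–§D of the model file; the `ℚ`-level display
("there is `K` such that …") is their specialisation once that data layer is typed.

## References
* [YanZhu2024MainConjNonCM] X. Yan, X. Zhu, J. Algebra 693 (2026) = arXiv:2412.20078v4: §5.1 Thm. 5.2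
  and its proof (TeX l.1060–1160; = v2 Thm. 4.9, §4.4 p. 11), Thm. 4.2 (l.932–949), Lemma 5.3
  (l.1083–1139), Prop. 3.7 (l.821–829).
* [GreenbergVatsal2000] R. Greenberg, V. Vatsal, Invent. Math. 142 (2000), Prop. 3.7, p. 2 (1)–(2).
* [GreenbergLNM1716] R. Greenberg, LNM 1716 (1999), Conj. 1.11.
-/

set_option autoImplicit false

noncomputable section

open scoped Classical

open PowerSeries NumberField IsDedekindDomain Field CongruenceSubgroup
  Literature.NumberTheory.GaloisRepresentations Literature.NumberTheory.EllipticCurves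
  Literature.NumberTheory.EllipticCurves.ModularForms Literature.NumberTheory.EllipticCurves.Rank1Residual

namespace Literature.NumberTheory.EllipticCurves.YanZhu2026

open IwasawaAlgebra₂

variable {p : ℕ} [Fact p.Prime]

/-! ## §1. The two-fold product divisibility on the cyclotomic line -/

/-- **Yan–Zhu 2026, proof of Thm. 5.2 (v4 l.1141–1147): `Char(X(E/ℚ_∞)) · Char(X(E^K/ℚ_∞)) ⊆
(𝓛_p^MSD(E/ℚ) · 𝓛_p^MSD(E^K/ℚ))` in `Λ_ℚ`, PROVED from Lemma 5.3, Prop. 3.7 and the divisibility (DIV) of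
Thm. 4.2 (1).** Data and hypotheses as in `spanLeIdeal_perrinRiou_of_facts` of the model file, except:
no (Im), no Kato input; the cyclotomic generator `γ` of the dual data is arbitrary (`hγ`), `γ₁|_{ℚ̄}` is a
generator matching the cyclotomic variable (`hγ₁`, `hγ₁'`); the Néron ratios are `p`-adic units
(`hϖu`, `hϖu'`: Greenberg–Vatsal Rem. 3.4, the tree facts `realPeriodRat_eq_unit_mul_plusPeriod(_three)`);
`E[p]` irreducible over `ℚ` (`hirr`, for the integrality of `L_p(f_E)`, Greenberg–Vatsal Prop. 3.7) and
over `K` (`hirrK`, Lemma 5.3). Conclusion: some `G₀ ∈ Λ_ℚ` with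
`ι G₀ = (ϖ · L_p(f_E, α)) · (ϖ' · L_p(g, α'))` satisfies `Char(X(E)) · Char(X(E^K)) ≤ (G₀)`.
[cite: YanZhu2024MainConjNonCM, Proof of Thm. 5.2 (§5.1 of arXiv:2412.20078v4 = J. Algebra 693 (2026); = Thm. 4.9 of v2), with Thm. 4.2 (1), Lemma 5.3, Prop. 3.7]
[cite: GreenbergVatsal2000, Prop. 3.7] -/
theorem prod_charIdeal_le_span_of_facts
    (h53 : lemma53_charIdeal_mul_charIdeal_le_toPlus_charIdeal)
    (h37 : prop37_cycRestrict_perrinRiou_eq_padicLFunction_mul)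
    (ι : integralClosure ℚ ℂ →+* ℂ_[p]) (W : WeierstrassCurve ℚ) [W.IsElliptic] [W.IsGloballyMinimal]
    (K : Type) [Field K] [NumberField K] (κ₁ κ₂ : ZpExtension K p) (γ₁ γ₂ : absoluteGaloisGroup K)
    [Fact (ZpExtension.IsTopGeneratorPair κ₁ κ₂ γ₁ γ₂)] {N : ℕ} [NeZero N]
    (π : ModularParametrizationData W N) (κ : ZpExtension ℚ p) (γ : absoluteGaloisGroup ℚ)
    (D : W.SelmerDualData κ γ)
    (D' : (W.quadraticTwist (NumberField.discr K : ℚ)).SelmerDualData κ γ)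
    (ϖ : ℚ) (W' : WeierstrassCurve ℚ) [W'.IsElliptic] [W'.IsGloballyMinimal]
    {N' : ℕ} [NeZero N'] (g : CuspForm (Gamma0 N') 2) (ϖ' : ℚ)
    (hlevel : (N : ℤ) = W.conductorNorm ℤ) (hp : 3 ≤ p) (hord : GoodOrd W p) (hirr : Irr W p)
    (hK : IsImaginaryQuadratic K)
    (hsplit : ((Ideal.span {(p : ℤ)}).primesOver (𝓞 K)).ncard = 2)
    (hN : IsCoprime (N : ℤ) (NumberField.discr K))
    (hirrK : (W.baseChange K).HasIrreducibleModPGaloisRep p)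
    (hκ₁ : κ₁.IsCyclotomic) (hκ₂ : κ₂.IsAnticyclotomic) (hκ : κ.IsCyclotomic)
    (hγ : κ.IsTopGenerator γ) (hγ₁ : κ.IsTopGenerator (absGaloisRestrict ℚ K γ₁))
    (hγ₁' : IsCyclotomicVariable p (absGaloisRestrict ℚ K γ₁))
    (hϖ : (ϖ : ℝ) * W.realPeriodRat = plusPeriod π.f) (hϖu : ‖(ϖ : ℚ_[p])‖ = 1)
    (hW' : ∃ C : WeierstrassCurve.VariableChange ℚ, C • W' = W.quadraticTwist (NumberField.discr K : ℚ))
    (hg : IsNewformOf W' g) (hϖ' : (ϖ' : ℝ) * W'.realPeriodRat = plusPeriod g)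
    (hϖu' : ‖(ϖ' : ℚ_[p])‖ = 1) (hord' : GoodOrd W' p)
    {F : CycAntiSeries p} (hF : IsHidaRankinLFunction ι W κ₁ κ₂ π.f F)
    (hdiv : IdealLeSpan (WeierstrassCurve.XOrd₂.charIdeal (W.baseChange K) p κ₁ κ₂ γ₁ γ₂)
      (perrinRiouLFunction W π F)) :
    ∃ G₀ : IwasawaAlgebra p,
      iwasawaToPowerSeries p G₀ =
          (PowerSeries.C (ϖ : ℚ_[p]) * padicLFunction π.f (unitRoot W p : ℚ_[p])) *
          (PowerSeries.C (ϖ' : ℚ_[p]) * padicLFunction g (unitRoot W' p : ℚ_[p])) ∧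
        D.charIdeal * D'.charIdeal ≤ Ideal.span {G₀} := by
  -- the level of `π` is `N_E`
  obtain rfl : N = W.conductorNorm ℤ := by exact_mod_cast hlevel
  have hp2 : p ≠ 2 := by omega
  obtain ⟨C, hC⟩ := hW'
  have hd : (NumberField.discr K : ℚ) ≠ 0 := by exact_mod_cast NumberField.discr_ne_zero K
  have hirr' : Irr W' p := irr_of_smul_eq_quadraticTwist W W' hd hC hirr
  -- integral avatars `M, M'` of the two MSD-normalised `p`-adic `L`-functions
  have hintC : ∀ (V : WeierstrassCurve ℚ) [V.IsElliptic] [V.IsGloballyMinimal],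
      GoodOrd V p → Irr V p → ∀ {M : ℕ} [NeZero M] (φ : CuspForm (Gamma0 M) 2), IsNewformOf V φ →
      ∀ (c : ℚ), ‖(c : ℚ_[p])‖ = 1 →
      ∃ Mc : IwasawaAlgebra p, iwasawaToPowerSeries p Mc =
        PowerSeries.C (c : ℚ_[p]) * padicLFunction φ (unitRoot V p : ℚ_[p]) := by
    intro V _ _ hV hVirr M _ φ hφ c hc
    refine (exists_iwasawaToPowerSeries_eq_iff_norm_coeff_le_one _).mpr fun k => ?_
    rw [PowerSeries.coeff_C_mul, norm_mul, hc, one_mul, coeff_padicLFunction]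
    exact padicLFunction_mem_integral_holds hp2 ⟨hV.1, hV.2⟩ hφ hVirr k
  obtain ⟨M, hM⟩ := hintC W hord hirr π.f π.isNewformOf ϖ hϖu
  obtain ⟨M', hM'⟩ := hintC W' hord' hirr' g hg ϖ' hϖu'
  refine ⟨M * M', by rw [map_mul, hM, hM'], ?_⟩
  -- Prop. 3.7: `𝓛⁺ = ι(u) · ϖϖ' · L_p(f_E) L_p(g) = ι(u · M · M')`
  obtain ⟨u, hu⟩ := h37 ι W K κ₁ κ₂ γ₁ γ₂ π ϖ W' g ϖ' hp hord hK hsplit hN hκ₁ hκ₂ hγ₁' hϖ ⟨C, hC⟩ hg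
    hϖ' F hF
  have hL : cycRestrict (perrinRiouLFunction W π F) =
      iwasawaToPowerSeries p ((u : IwasawaAlgebra p) * (M * M')) := by
    rw [hu, map_mul, map_mul, hM, hM', Rat.cast_mul, map_mul]
    ring
  -- the product of the characteristic ideals, generator by generator
  refine Ideal.mul_le.mpr fun a ha b hb => ?_
  -- Lemma 5.3: `G ∈ Char(X(E/K_∞))` with `Ḡ = a b`
  obtain ⟨G, hGmem, hGeq⟩ := h53 W K κ₁ κ₂ γ₁ γ₂ κ γ D D' hp hord hK hsplit (by exact_mod_cast hN) hirrK
    hκ₁ hκ₂ hκ hγ hγ₁ a ha b hb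
  -- (DIV) at `G`, restricted to the cyclotomic line: `a b = u · (M M') · h̄`
  obtain ⟨h, hh⟩ := hdiv G hGmem
  have hred : a * b = (u : IwasawaAlgebra p) * (M * M') * toPlus p h := by
    apply iwasawaToPowerSeries_injective p
    have h1 := congrArg cycRestrict hh
    rw [cycRestrict_mul, cycRestrict_toCycAnti, cycRestrict_toCycAnti, hL, ← map_mul, hGeq] at h1
    exact h1
  rw [hred]
  exact Ideal.mem_span_singleton'.mpr ⟨(u : IwasawaAlgebra p) * toPlus p h, by ring⟩

/-! ## §2. Mazur's identity in `Λ_ℚ` from the product divisibility and `μ = 0` at `E` and `E^K` -/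

/-- **`Char_{Λ_ℚ}(X(E/ℚ_∞)) = (L_p(f_E, α))` IN `Λ_ℚ` at an odd good ordinary prime with irreducible
`ρ̄_{E,p}`, from Yan–Zhu's inputs and the vanishing of `μ` at `E` and at `E^K`.** Data and hypotheses as
in §1, plus the rational clause of the cyclotomic theorem (`h49`, `thm49_charIdeal_eq_padicLFunction`:
`ι gᵢ = p^{kᵢ} · L_p`, `kᵢ ∈ ℤ` free, at `E` and at the minimal model `W'` of `E^K`), the cyclotomic
variable for `γ` (`hγ'`), and the OPEN binders `μ(X(E/ℚ_∞)) = 0` (`hμ : D.mu = 0`) and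
`μ(X(E^K/ℚ_∞)) = 0` (`hμ' : D'.mu = 0`) — Greenberg's Conjecture 1.11 at the two curves, taken as
hypotheses. Then `X(E/ℚ_∞)` is `Λ`-torsion and `Char = (g₀)`, `ι g₀ = L_p(f_E, α)` on the nose (the
theorem's second clause with neither (Im) nor an analytic certificate). Proof: `kᵢ ≤ 0` by unit content
and integrality (`exponent_nonpos_of_hasUnitContent`); `k + k' ≥ 0` by §1
(`exponents_eq_zero_of_prod_mem_span`, two factors padded by `1`); `L_p ≠ 0` (Rohrlich,
`padicLFunction_unitRoot_ne_zero`). [cite: YanZhu2024MainConjNonCM, Thm. 4.9 (§4.4 of arXiv:2412.20078v2) = Thm. 5.2 and its proof (§5.1 of v4)]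
[cite: GreenbergVatsal2000, Prop. 3.7 and p. 2, (1)–(2)] [cite: GreenbergLNM1716, §1 Conj. 1.11] -/
theorem charIdeal_eq_padicLFunction_of_mu_eq_zero_of_facts
    (h49 : thm49_charIdeal_eq_padicLFunction)
    (h53 : lemma53_charIdeal_mul_charIdeal_le_toPlus_charIdeal)
    (h37 : prop37_cycRestrict_perrinRiou_eq_padicLFunction_mul)
    (ι : integralClosure ℚ ℂ →+* ℂ_[p]) (W : WeierstrassCurve ℚ) [W.IsElliptic] [W.IsGloballyMinimal]
    (K : Type) [Field K] [NumberField K] (κ₁ κ₂ : ZpExtension K p) (γ₁ γ₂ : absoluteGaloisGroup K)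
    [Fact (ZpExtension.IsTopGeneratorPair κ₁ κ₂ γ₁ γ₂)] {N : ℕ} [NeZero N]
    (π : ModularParametrizationData W N) (κ : ZpExtension ℚ p) (γ : absoluteGaloisGroup ℚ)
    (D : W.SelmerDualData κ γ)
    (D' : (W.quadraticTwist (NumberField.discr K : ℚ)).SelmerDualData κ γ)
    (ϖ : ℚ) (W' : WeierstrassCurve ℚ) [W'.IsElliptic] [W'.IsGloballyMinimal]
    {N' : ℕ} [NeZero N'] (g : CuspForm (Gamma0 N') 2) (ϖ' : ℚ)
    (hlevel : (N : ℤ) = W.conductorNorm ℤ) (hp : 3 ≤ p) (hord : GoodOrd W p) (hirr : Irr W p)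
    (hK : IsImaginaryQuadratic K)
    (hsplit : ((Ideal.span {(p : ℤ)}).primesOver (𝓞 K)).ncard = 2)
    (hN : IsCoprime (N : ℤ) (NumberField.discr K))
    (hirrK : (W.baseChange K).HasIrreducibleModPGaloisRep p)
    (hκ₁ : κ₁.IsCyclotomic) (hκ₂ : κ₂.IsAnticyclotomic) (hκ : κ.IsCyclotomic)
    (hγ : κ.IsTopGenerator γ) (hγ' : IsCyclotomicVariable p γ)
    (hγ₁ : κ.IsTopGenerator (absGaloisRestrict ℚ K γ₁))
    (hγ₁' : IsCyclotomicVariable p (absGaloisRestrict ℚ K γ₁))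
    (hϖ : (ϖ : ℝ) * W.realPeriodRat = plusPeriod π.f) (hϖu : ‖(ϖ : ℚ_[p])‖ = 1)
    (hW' : ∃ C : WeierstrassCurve.VariableChange ℚ, C • W' = W.quadraticTwist (NumberField.discr K : ℚ))
    (hg : IsNewformOf W' g) (hϖ' : (ϖ' : ℝ) * W'.realPeriodRat = plusPeriod g)
    (hϖu' : ‖(ϖ' : ℚ_[p])‖ = 1) (hord' : GoodOrd W' p)
    {F : CycAntiSeries p} (hF : IsHidaRankinLFunction ι W κ₁ κ₂ π.f F)
    (hdiv : IdealLeSpan (WeierstrassCurve.XOrd₂.charIdeal (W.baseChange K) p κ₁ κ₂ γ₁ γ₂)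
      (perrinRiouLFunction W π F))
    (hμ : D.mu = 0) (hμ' : D'.mu = 0) :
    D.IsTorsion ∧ ∃ g₀ : IwasawaAlgebra p, D.charIdeal = Ideal.span {g₀} ∧
      iwasawaToPowerSeries p g₀ = padicLFunction π.f (unitRoot W p : ℚ_[p]) := by
  have hp2 : p ≠ 2 := by omega
  have hpP : p.Prime := Fact.out
  obtain ⟨C, hC⟩ := hW'
  have hd : (NumberField.discr K : ℚ) ≠ 0 := by exact_mod_cast NumberField.discr_ne_zero K
  have hirr' : Irr W' p := irr_of_smul_eq_quadraticTwist W W' hd hC hirr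
  -- §1: the product divisibility on the generators
  obtain ⟨G₀, hιG₀, hle⟩ := prod_charIdeal_le_span_of_facts h53 h37 ι W K κ₁ κ₂ γ₁ γ₂ π κ γ D D' ϖ W' g ϖ'
    hlevel hp hord hirr hK hsplit hN hirrK hκ₁ hκ₂ hκ hγ hγ₁ hγ₁' hϖ hϖu ⟨C, hC⟩ hg hϖ' hϖu' hord' hF hdiv
  -- the rational clause at `E` and at the minimal model `W'` of `E^K` (datum transported from `D'`)
  obtain ⟨ht, g₀, k, hc, hι⟩ := h49 W p κ γ π.f hp hord.1 hord.2 hirr hκ hγ hγ' π.isNewformOf D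
  obtain ⟨D'', hchar'', htors''⟩ := IsogenySelmerInfty.exists_selmerDualData_of_smul_eq p hC D'
  obtain ⟨ht'', g₁, k', hc'', hι'⟩ := h49 W' p κ γ g hp hord'.1 hord'.2 hirr' hκ hγ hγ' hg D''
  have ht' : D'.IsTorsion := htors''.mp ht''
  have hc' : D'.charIdeal = Ideal.span {g₁} := hchar'' ▸ hc''
  -- `μ = 0` as unit content of the generators
  haveI : Module.Finite (IwasawaAlgebra p) D.X := D.module_finite_holds hγ
  haveI := W.isElliptic_quadraticTwist hd
  haveI : Module.Finite (IwasawaAlgebra p) D'.X := D'.module_finite_holds hγ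
  have hu₀ : GreenbergVatsal2000.HasUnitContent g₀ :=
    (GreenbergVatsal2000.mu_eq_zero_iff_hasUnitContent D ht hc).mp hμ
  have hu₁ : GreenbergVatsal2000.HasUnitContent g₁ :=
    (GreenbergVatsal2000.mu_eq_zero_iff_hasUnitContent D' ht' hc').mp hμ'
  -- integrality ⟹ `k, k' ≤ 0`
  have hint : ∀ (V : WeierstrassCurve ℚ) [V.IsElliptic] [V.IsGloballyMinimal],
      GoodOrd V p → Irr V p → ∀ {M : ℕ} [NeZero M] (φ : CuspForm (Gamma0 M) 2), IsNewformOf V φ →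
      ∀ n : ℕ, ‖PowerSeries.coeff n (padicLFunction φ (unitRoot V p : ℚ_[p]))‖ ≤ 1 := by
    intro V _ _ hV hVirr M _ φ hφ n
    rw [coeff_padicLFunction]
    exact padicLFunction_mem_integral_holds hp2 ⟨hV.1, hV.2⟩ hφ hVirr n
  have hk : k ≤ 0 :=
    exponent_nonpos_of_hasUnitContent g₀ _ k hι (hint W hord hirr π.f π.isNewformOf) hu₀
  have hk' : k' ≤ 0 := exponent_nonpos_of_hasUnitContent g₁ _ k' hι' (hint W' hord' hirr' g hg) hu₁
  obtain ⟨m, hm⟩ := Int.exists_eq_neg_ofNat hk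
  obtain ⟨m', hm'⟩ := Int.exists_eq_neg_ofNat hk'
  have hp0 : (p : ℚ_[p]) ≠ 0 := by exact_mod_cast hpP.ne_zero
  have flip : ∀ (a : IwasawaAlgebra p) (L : PowerSeries ℚ_[p]) (n : ℕ),
      iwasawaToPowerSeries p a = PowerSeries.C ((p : ℚ_[p]) ^ (-(n : ℤ))) * L →
      PowerSeries.C ((p : ℚ_[p]) ^ n) * iwasawaToPowerSeries p a = L := by
    intro a L n h
    rw [h, ← mul_assoc, ← map_mul, zpow_neg, zpow_natCast, mul_inv_cancel₀ (pow_ne_zero _ hp0),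
      map_one, one_mul]
  have e₀ := flip g₀ _ m (hm ▸ hι)
  have e₁ := flip g₁ _ m' (hm' ▸ hι')
  have e1 : PowerSeries.C ((p : ℚ_[p]) ^ 0) * iwasawaToPowerSeries p 1 = 1 := by
    rw [pow_zero, map_one, map_one, one_mul]
  -- the two `p`-adic `L`-functions are nonzero (Rohrlich)
  set L₀ := padicLFunction π.f (unitRoot W p : ℚ_[p]) with hL₀
  set L₁ := padicLFunction g (unitRoot W' p : ℚ_[p]) with hL₁
  have hLprod : L₀ * L₁ * 1 * 1 ≠ 0 := by
    rw [mul_one, mul_one]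
    exact mul_ne_zero (padicLFunction_unitRoot_ne_zero ⟨hord.1, hord.2⟩ π.isNewformOf)
      (padicLFunction_unitRoot_ne_zero ⟨hord'.1, hord'.2⟩ hg)
  -- the product divisibility on the generators, unit-normalised
  set c : ℚ_[p] := (ϖ : ℚ_[p]) * (ϖ' : ℚ_[p]) with hcdef
  have hcn : ‖c‖ ≤ 1 := by rw [hcdef, norm_mul, hϖu, hϖu']; norm_num
  have hιG₀' : iwasawaToPowerSeries p G₀ = PowerSeries.C c * (L₀ * L₁ * 1 * 1) := by
    rw [hιG₀, hcdef, map_mul, mul_one, mul_one]; ring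
  have hGmem : g₀ * g₁ * 1 * 1 ∈ Ideal.span {G₀} := by
    rw [mul_one, mul_one]
    refine hle (Ideal.mul_mem_mul ?_ ?_)
    · rw [hc]; exact Ideal.mem_span_singleton_self _
    · rw [hc']; exact Ideal.mem_span_singleton_self _
  obtain ⟨hm0, -, -, -⟩ := exponents_eq_zero_of_prod_mem_span e₀ e₁ e1 e1 hLprod hcn hιG₀' hGmem
  refine ⟨ht, g₀, hc, ?_⟩
  rw [← e₀, hm0, pow_zero, map_one, one_mul]

end Literature.NumberTheory.EllipticCurves.YanZhu2026

end
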